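import Summits.CriticalPhenomena.Ising3DConformalLimit.Theses.HelsonAxis
import Summits.CriticalPhenomena.Ising3DConformalLimit.Theses.MirrorHoelderCompactness
import Summits.CriticalPhenomena.Ising3DConformalLimit.Theses.IsingEuclidUpgrade
import Summits.CriticalPhenomena.Ising3DConformalLimit.Theorems.MonotoneBlockingLimitsAreConformalSummit
import Summits.CriticalPhenomena.Ising3DConformalLimit.Theorems.HyperoctahedralRPExistsScaleCovariantLimitFunnelThroughDoubling
import Literature.Probability.LatticeModels.PointwiseScalingLimitEtaExists
import HarnessLib

/-!
# Redirect certificate r1 — crux `AxialHelsonCone` (item stmt-CriticalPhenomena-18121)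

Crux-strategist REDIRECT scan (likely-fail), route `route-CriticalPhenomena-HelsonAxis`, sub-problem
`CriticalPhenomena/Ising3DConformalLimit`, S = `_root_.Ising3DConformalLimit`.

The crux C (verbatim, rev 7 of the route file):
`∃ ℓ₀ > 0, ∀ N ≥ ℓ₀, ∀ b ≥ 1, g(N b)² ≤ g(N) · g(N b²)` with `g n = ⟨σ₀ σ_{n e₁}⟩_{β_c}` on `ℤ³`
(eventual multiplicative mid-point log-convexity of the critical axis two-point function).

This file is strategist EVIDENCE (CRUX WORKFILES), not a route item and not a Theorems proposal.
It records, kernel-checked and `sorry`-free: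

* §1  the abstract engine: a positive antitone sequence obeying the cone from some `ℓ₀ > 0` has
      ALL-SCALE DOUBLING and a DECAY EXPONENT (ratio `f(2m)/f(m)` is non-decreasing along doubling;
      the dyadic log-increments are monotone and bounded, hence converge; Cesàro; dyadic fill-in);
* §2  C ⟹ hub item 6150 `MirrorHoelderCompactness.TwoPointDoubling`;
* §3  C ⟹ hub item 0635 `IsingEuclidUpgrade.IsingEuclidUpgradeR3EtaExists` (with `0 ≤ η ≤ 1/2`);
* §4  S ⟹ the same two hubs (tree theorems, restated here so the census cites one file);
* §5  PROFILE SEPARATION: the Hausdorff moment sequence `h n = 1/(n+1) = ∫₀¹ xⁿ dx` is positive,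
      antitone, discretely log-convex, doubling, and has an EXACT power law with amplitude
      (`n · h n → 1`) — every axis-profile property the tree derives from S, and more — yet it
      violates the cone at every scale (`h N · h(N b²) < h(N b)²` for all `N ≥ 1`, `b ≥ 2`).
      So the residual content of C over the hubs is a SIGN CONDITION on the corrections to scaling
      (first sub-leading axial term non-negative), which no summit-level statement supplies:
      S ↛ C by any argument factoring through the axial profile class, and C ↛ S (C is silent
      off-axis and on `U₄`) — the crux is neither weaker-with-teeth nor the summit in costume.

[cite: MessagerMiracleSoleJSP1977; AizenmanDuminilCopinAnnals2021, arXiv:1912.07973 Remark 5.10;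
DuminilCopinPanis2025LowerBounds, Theorem 1.5; Grimmett1999, §9.1]
-/

open Filter Topology Set
open Literature.Probability.LatticeModels
open Summit.CriticalPhenomena.Ising3DConformalLimit.Theses
open Summit.CriticalPhenomena.Ising3DConformalLimit.Theorems.LimitsAreConformalSummit
open Summit.CriticalPhenomena.Ising3DConformalLimit.Cruxes.ExistsScaleCovariantLimit

namespace Summit.CriticalPhenomena.Ising3DConformalLimit.Cruxes.AxialHelsonCone.RedirectR1

noncomputable section

/-! ## §0 The axis sequence and the crux, unfolded -/

/-- The critical axis two-point function `g n = ⟨σ₀ σ_{n e₁}⟩_{β_c}` on `ℤ³`. -/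
abbrev g (n : ℕ) : ℝ := criticalTwoPoint 3 (Pi.single (0 : Fin 3) (n : ℤ))

theorem g_pos (n : ℕ) : 0 < g n := criticalTwoPoint_axis_pos n

theorem g_antitone : Antitone g := criticalTwoPoint_axis_antitone

/-- The abstract cone hypothesis at threshold `ℓ₀` for a sequence `f`. -/
def Cone (f : ℕ → ℝ) (ℓ₀ : ℕ) : Prop :=
  ∀ N b : ℕ, ℓ₀ ≤ N → 1 ≤ b → f (N * b) ^ 2 ≤ f N * f (N * b ^ 2)

/-- The crux is literally `∃ ℓ₀ > 0, Cone g ℓ₀`. -/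
theorem crux_iff : HelsonAxis.AxialHelsonCone ↔ ∃ ℓ₀ : ℕ, 0 < ℓ₀ ∧ Cone g ℓ₀ := Iff.rfl

/-! ## §1 The abstract engine: cone ⟹ doubling and a decay exponent -/

section Abstract

variable {f : ℕ → ℝ} {ℓ₀ : ℕ}

/-- Cone at `b = 2`: the doubling ratio `f(2m)/f(m)` is non-decreasing along doubling, in product
form `f(2m)·f(2m) ≤ f(m)·f(4m)` for `m ≥ ℓ₀`. -/
theorem sq_double_le (hcone : Cone f ℓ₀) {m : ℕ} (hm : ℓ₀ ≤ m) :
    f (2 * m) ^ 2 ≤ f m * f (4 * m) := by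
  have h := hcone m 2 hm (by norm_num)
  have e1 : m * 2 = 2 * m := by ring
  have e2 : m * 2 ^ 2 = 4 * m := by ring
  rwa [e1, e2] at h

/-- The dyadic ratios `R j = f(2^{j+1} ℓ₀) / f(2^j ℓ₀)` are non-decreasing in `j`. -/
theorem ratio_monotone (hpos : ∀ n, 0 < f n) (hcone : Cone f ℓ₀) :
    Monotone (fun j : ℕ => f (2 ^ (j + 1) * ℓ₀) / f (2 ^ j * ℓ₀)) := by
  refine monotone_nat_of_le_succ fun j => ?_
  have hm : ℓ₀ ≤ 2 ^ j * ℓ₀ := Nat.le_mul_of_pos_left ℓ₀ (Nat.two_pow_pos j)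
  have h := sq_double_le hcone hm
  have e1 : 2 * (2 ^ j * ℓ₀) = 2 ^ (j + 1) * ℓ₀ := by ring
  have e2 : 4 * (2 ^ j * ℓ₀) = 2 ^ (j + 1 + 1) * ℓ₀ := by ring
  rw [e1, e2] at h
  have hA := hpos (2 ^ j * ℓ₀)
  have hB := hpos (2 ^ (j + 1) * ℓ₀)
  show f (2 ^ (j + 1) * ℓ₀) / f (2 ^ j * ℓ₀) ≤ f (2 ^ (j + 1 + 1) * ℓ₀) / f (2 ^ (j + 1) * ℓ₀)
  rw [div_le_div_iff₀ hA hB]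
  nlinarith [h]

/-- Iterating: `f(2^{j+1} ℓ₀) ≥ r₀ · f(2^j ℓ₀)` with `r₀ = f(2ℓ₀)/f(ℓ₀)`, for every `j`. -/
theorem dyadic_step_ge (hpos : ∀ n, 0 < f n) (hcone : Cone f ℓ₀) (j : ℕ) :
    f (2 * ℓ₀) / f ℓ₀ * f (2 ^ j * ℓ₀) ≤ f (2 ^ (j + 1) * ℓ₀) := by
  have hmono := ratio_monotone hpos hcone (Nat.zero_le j)
  simp only [pow_zero, one_mul, zero_add, pow_one] at hmono
  have hA := hpos (2 ^ j * ℓ₀)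
  rw [le_div_iff₀ hA] at hmono
  exact hmono

/-- **Cone ⟹ all-scale doubling** for a positive antitone sequence. -/
theorem doubling_of_cone (hpos : ∀ n, 0 < f n) (hanti : Antitone f) (hℓ : 0 < ℓ₀)
    (hcone : Cone f ℓ₀) : ∃ κ : ℝ, 0 < κ ∧ ∀ n : ℕ, κ * f n ≤ f (2 * n) := by
  set r₀ : ℝ := f (2 * ℓ₀) / f ℓ₀ with hr₀
  set s₀ : ℝ := f (2 * ℓ₀) / f 0 with hs₀
  have hr₀pos : 0 < r₀ := div_pos (hpos _) (hpos _)
  have hs₀pos : 0 < s₀ := div_pos (hpos _) (hpos _)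
  have hr₀le : r₀ ≤ 1 := (div_le_one (hpos _)).2 (hanti (by omega))
  have hs₀le : s₀ ≤ 1 := (div_le_one (hpos _)).2 (hanti (Nat.zero_le _))
  refine ⟨r₀ ^ 2 * s₀, by positivity, fun n => ?_⟩
  by_cases hn : ℓ₀ ≤ n
  · -- dyadic bracketing of n by 2^k ℓ₀ ≤ n < 2^(k+1) ℓ₀
    set q := n / ℓ₀ with hq
    have hq1 : 1 ≤ q := (Nat.one_le_div_iff hℓ).2 hn
    set k := Nat.log 2 q with hk
    have hlow : 2 ^ k * ℓ₀ ≤ n :=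
      (Nat.mul_le_mul_right ℓ₀ (Nat.pow_log_le_self 2 (by omega))).trans (Nat.div_mul_le_self n ℓ₀)
    have hup : 2 * n ≤ 2 ^ (k + 1 + 1) * ℓ₀ := by
      have h1 : q < 2 ^ (k + 1) := Nat.lt_pow_succ_log_self one_lt_two q
      have h2 : n < q * ℓ₀ + ℓ₀ := Nat.lt_div_mul_add hℓ
      have h3 : (q + 1) * ℓ₀ ≤ 2 ^ (k + 1) * ℓ₀ := Nat.mul_le_mul_right ℓ₀ h1
      have h4 : n < 2 ^ (k + 1) * ℓ₀ := by
        have : q * ℓ₀ + ℓ₀ = (q + 1) * ℓ₀ := by ring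
        omega
      calc 2 * n ≤ 2 * (2 ^ (k + 1) * ℓ₀) := by omega
        _ = 2 ^ (k + 1 + 1) * ℓ₀ := by ring
    have hA : f (2 ^ (k + 1 + 1) * ℓ₀) ≤ f (2 * n) := hanti hup
    have hB : f n ≤ f (2 ^ k * ℓ₀) := hanti hlow
    have s1 := dyadic_step_ge hpos hcone k
    have s2 := dyadic_step_ge hpos hcone (k + 1)
    have hfn := hpos n
    have hfk := hpos (2 ^ k * ℓ₀)
    calc r₀ ^ 2 * s₀ * f n ≤ r₀ ^ 2 * 1 * f n := by gcongr
      _ = r₀ * (r₀ * f n) := by ring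
      _ ≤ r₀ * (r₀ * f (2 ^ k * ℓ₀)) := by gcongr
      _ ≤ r₀ * f (2 ^ (k + 1) * ℓ₀) := by gcongr
      _ ≤ f (2 ^ (k + 1 + 1) * ℓ₀) := s2
      _ ≤ f (2 * n) := hA
  · rw [not_le] at hn
    have hA : f (2 * ℓ₀) ≤ f (2 * n) := hanti (by omega)
    have hB : f n ≤ f 0 := hanti (Nat.zero_le _)
    have hf0 := hpos 0
    have hfn := hpos n
    calc r₀ ^ 2 * s₀ * f n ≤ 1 ^ 2 * s₀ * f n := by gcongr
      _ = f (2 * ℓ₀) / f 0 * f n := by rw [one_pow, one_mul]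
      _ ≤ f (2 * ℓ₀) / f 0 * f 0 := by gcongr
      _ = f (2 * ℓ₀) := div_mul_cancel₀ _ hf0.ne'
      _ ≤ f (2 * n) := hA

/-- The dyadic log-increments `d k = log f(2^{k+ℓ₀+1}) - log f(2^{k+ℓ₀})` are monotone (cone at the
scales `2^{k+ℓ₀} ≥ ℓ₀`) and non-positive (antitone `f`). -/
theorem logIncr_monotone (hpos : ∀ n, 0 < f n) (hcone : Cone f ℓ₀) :
    Monotone (fun k : ℕ => Real.log (f (2 ^ (k + ℓ₀ + 1))) - Real.log (f (2 ^ (k + ℓ₀)))) := by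
  refine monotone_nat_of_le_succ fun k => ?_
  have hm : ℓ₀ ≤ 2 ^ (k + ℓ₀) :=
    (Nat.lt_two_pow_self).le.trans (Nat.pow_le_pow_right (by norm_num) (Nat.le_add_left ℓ₀ k))
  have h := sq_double_le hcone hm
  have e1 : 2 * 2 ^ (k + ℓ₀) = 2 ^ (k + ℓ₀ + 1) := by ring
  have e2 : 4 * 2 ^ (k + ℓ₀) = 2 ^ (k + 1 + ℓ₀ + 1) := by ring
  have e3 : (2 : ℕ) ^ (k + 1 + ℓ₀) = 2 ^ (k + ℓ₀ + 1) := by ring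
  rw [e1, e2] at h
  show Real.log (f (2 ^ (k + ℓ₀ + 1))) - Real.log (f (2 ^ (k + ℓ₀))) ≤
    Real.log (f (2 ^ (k + 1 + ℓ₀ + 1))) - Real.log (f (2 ^ (k + 1 + ℓ₀)))
  rw [e3, ← Real.log_div (hpos _).ne' (hpos _).ne', ← Real.log_div (hpos _).ne' (hpos _).ne']
  refine Real.log_le_log (div_pos (hpos _) (hpos _)) ?_
  rw [div_le_div_iff₀ (hpos _) (hpos _)]
  nlinarith [h, hpos (2 ^ (k + ℓ₀ + 1))]

theorem logIncr_nonpos (hpos : ∀ n, 0 < f n) (hanti : Antitone f) (k : ℕ) :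
    Real.log (f (2 ^ (k + ℓ₀ + 1))) - Real.log (f (2 ^ (k + ℓ₀))) ≤ 0 := by
  have h : f (2 ^ (k + ℓ₀ + 1)) ≤ f (2 ^ (k + ℓ₀)) :=
    hanti (Nat.pow_le_pow_right (by norm_num) (Nat.le_succ _))
  linarith [Real.log_le_log (hpos _) h]

/-- **Cone ⟹ the dyadic exponent exists**: `log f(2^k) / k` converges (to the supremum `L' ≤ 0` of
the monotone bounded log-increments, by Cesàro). -/
theorem tendsto_log_dyadic_of_cone (hpos : ∀ n, 0 < f n) (hanti : Antitone f) (hcone : Cone f ℓ₀) :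
    ∃ L' : ℝ, L' ≤ 0 ∧ Tendsto (fun k : ℕ => Real.log (f (2 ^ k)) / k) atTop (𝓝 L') := by
  set d : ℕ → ℝ := fun k => Real.log (f (2 ^ (k + ℓ₀ + 1))) - Real.log (f (2 ^ (k + ℓ₀))) with hd
  have hmono : Monotone d := logIncr_monotone hpos hcone
  have hbdd : BddAbove (range d) := ⟨0, by rintro _ ⟨k, rfl⟩; exact logIncr_nonpos hpos hanti k⟩
  set L' : ℝ := ⨆ k, d k with hL'
  have hdlim : Tendsto d atTop (𝓝 L') := tendsto_atTop_ciSup hmono hbdd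
  have hL'le : L' ≤ 0 := ciSup_le fun k => logIncr_nonpos hpos hanti k
  refine ⟨L', hL'le, ?_⟩
  -- Cesàro on the increments: (log f(2^(k+ℓ₀)) - log f(2^ℓ₀)) / k → L'
  have hces := hdlim.cesaro
  set F : ℕ → ℝ := fun k => Real.log (f (2 ^ (k + ℓ₀))) with hF
  have hsum : ∀ k, ∑ i ∈ Finset.range k, d i = F k - F 0 := by
    intro k
    have := Finset.sum_range_sub F k
    simpa [hF, hd, Nat.add_right_comm] using this
  have h1 : Tendsto (fun k : ℕ => (F k - F 0) / k) atTop (𝓝 L') := by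
    refine hces.congr' (Eventually.of_forall fun k => ?_)
    simp only [hsum]
    rw [inv_mul_eq_div]
  have h2 : Tendsto (fun k : ℕ => F 0 / (k : ℝ)) atTop (𝓝 0) := tendsto_const_div_atTop_nhds_zero_nat _
  have h3 : Tendsto (fun k : ℕ => F k / k) atTop (𝓝 L') := by
    have := h1.add h2
    rw [add_zero] at this
    refine this.congr' (Eventually.of_forall fun k => ?_)
    simp only
    ring
  -- shift: F k / k = log f(2^(k+ℓ₀)) / k ; compare with log f(2^(k+ℓ₀)) / (k+ℓ₀)
  have h4 : Tendsto (fun k : ℕ => Real.log (f (2 ^ (k + ℓ₀))) / ((k + ℓ₀ : ℕ) : ℝ)) atTop (𝓝 L') := by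
    have h5 : Tendsto (fun k : ℕ => (k : ℝ) / ((k : ℝ) + ℓ₀)) atTop (𝓝 1) :=
      tendsto_natCast_div_add_atTop (ℓ₀ : ℝ)
    have h6 := h3.mul h5
    rw [mul_one] at h6
    refine h6.congr' ?_
    filter_upwards [eventually_gt_atTop 0] with k hk
    have hk' : (k : ℝ) ≠ 0 := by exact_mod_cast hk.ne'
    have hkℓ : (k : ℝ) + ℓ₀ ≠ 0 := by positivity
    simp only [hF]
    push_cast
    field_simp
  exact (tendsto_add_atTop_iff_nat ℓ₀).1 h4

/-- **Cone ⟹ a decay exponent `L ≥ 0` exists** (dyadic fill-in for antitone sequences,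
`HasDecayExponent.of_dyadic_of_antitone`). -/
theorem hasDecayExponent_of_cone (hpos : ∀ n, 0 < f n) (hanti : Antitone f) (hcone : Cone f ℓ₀) :
    ∃ L : ℝ, 0 ≤ L ∧ HasDecayExponent f L := by
  obtain ⟨L', hL', hlim⟩ := tendsto_log_dyadic_of_cone hpos hanti hcone
  have hl2 : 0 < Real.log 2 := Real.log_pos one_lt_two
  refine ⟨-L' / Real.log 2, div_nonneg (by linarith) hl2.le, ?_⟩
  refine HasDecayExponent.of_dyadic_of_antitone hpos hanti ?_
  have e : -(-L' / Real.log 2) * Real.log 2 = L' := by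
    field_simp
  rw [e]
  exact hlim

end Abstract

/-! ## §2 C ⟹ hub item 6150 (`TwoPointDoubling`) -/

/-- **C ⟹ 6150.** The axial Helson cone forces all-scale axis doubling of the critical two-point
function of `ℤ³` (MMS antitonicity + the `b = 2` cone). -/
theorem twoPointDoubling_of_axialHelsonCone (h : HelsonAxis.AxialHelsonCone) :
    MirrorHoelderCompactness.TwoPointDoubling := by
  obtain ⟨ℓ₀, hℓ, hcone⟩ := crux_iff.1 h
  obtain ⟨κ, hκ, hd⟩ := doubling_of_cone g_pos g_antitone hℓ hcone
  refine ⟨κ, hκ, fun n _ => ?_⟩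
  have := hd n
  simp only [g] at this
  push_cast at this
  exact this

/-! ## §3 C ⟹ hub item 0635 (`η` exists) -/

/-- An axial decay exponent `L` of `g` is the spatial exponent of `⟨σ₀σ_x⟩_{β_c}` in every direction
(MMS sphere sandwich `g(3‖y‖_∞) ≤ ⟨σ₀σ_y⟩ ≤ g(‖y‖_∞)`), i.e. `η = L - 1` exists. The bookkeeping is
that of `HasPointwiseScalingLimit.hasIsingExponentEta`, with the scaling-limit input replaced by the
abstract exponent. -/
theorem hasIsingExponentEta_of_axisExponent {L : ℝ} (hax : HasDecayExponent g L) :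
    HasIsingExponentEta 3 (L - 1) := by
  have hax3 := hax.comp_three_mul
  unfold HasDecayExponent at hax hax3
  have hn : Tendsto (fun y : Site 3 => Site.supNorm y) cofinite atTop := by
    have h := Site.tendsto_norm_cofinite_atTop (d := 3)
    simp_rw [Site.norm_eq_supNorm] at h
    exact tendsto_natCast_atTop_iff.1 h
  have hUp := hax.comp hn
  have hLo := hax3.comp hn
  have key : Tendsto (fun y : Site 3 => Real.log (criticalTwoPoint 3 y) / Real.log ‖y‖) cofinite
      (𝓝 (-L)) := by
    refine tendsto_of_tendsto_of_tendsto_of_le_of_le' hLo hUp ?_ ?_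
    · filter_upwards [hn.eventually (eventually_gt_atTop 1)] with y hy
      obtain ⟨hlo, -⟩ := criticalTwoPoint_axis_sandwich hy.le
      have hlog : 0 < Real.log ((Site.supNorm y : ℕ) : ℝ) := Real.log_pos (by exact_mod_cast hy)
      simp only [Function.comp_apply]
      rw [Site.norm_eq_supNorm]
      exact div_le_div_of_nonneg_right (Real.log_le_log (g_pos _) hlo) hlog.le
    · filter_upwards [hn.eventually (eventually_gt_atTop 1)] with y hy
      obtain ⟨hlo, hup⟩ := criticalTwoPoint_axis_sandwich hy.le
      have hlog : 0 < Real.log ((Site.supNorm y : ℕ) : ℝ) := Real.log_pos (by exact_mod_cast hy)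
      have hpos : 0 < criticalTwoPoint 3 y := (g_pos _).trans_le hlo
      simp only [Function.comp_apply]
      rw [Site.norm_eq_supNorm]
      exact div_le_div_of_nonneg_right (Real.log_le_log hpos hup) hlog.le
  unfold HasIsingExponentEta HasSpatialDecayExponent
  convert key using 2
  push_cast
  ring

/-- **C ⟹ 0635**, quantitatively: the cone gives an axial exponent `L ≥ 0`, hence `η = L - 1`
exists; Duminil-Copin–Panis cuts it to `η ≤ 1/2` and the infrared bound side of the tree is not even
needed for existence. -/
theorem etaExists_of_axialHelsonCone (h : HelsonAxis.AxialHelsonCone) :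
    ∃ η : ℝ, η ≤ 1/2 ∧ HasIsingExponentEta 3 η := by
  obtain ⟨ℓ₀, -, hcone⟩ := crux_iff.1 h
  obtain ⟨L, -, hL⟩ := hasDecayExponent_of_cone g_pos g_antitone hcone
  exact ⟨L - 1, dcp_isingEta_le_half_holds (L - 1) (hasIsingExponentEta_of_axisExponent hL),
    hasIsingExponentEta_of_axisExponent hL⟩

/-- **C ⟹ hub item 0635** (`IsingEuclidUpgrade.IsingEuclidUpgradeR3EtaExists`). -/
theorem isingEuclidUpgradeR3EtaExists_of_axialHelsonCone (h : HelsonAxis.AxialHelsonCone) :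
    IsingEuclidUpgrade.IsingEuclidUpgradeR3EtaExists := by
  obtain ⟨η, -, hη⟩ := etaExists_of_axialHelsonCone h
  exact ⟨η, hη⟩

/-! ## §4 S ⟹ the same hubs (tree theorems) -/

/-- **S ⟹ 6150** (the funnel through doubling, composed with `existsScaleCovariantLimit_of_summit`). -/
theorem twoPointDoubling_of_summit (h : _root_.Ising3DConformalLimit) :
    MirrorHoelderCompactness.TwoPointDoubling :=
  Funnel.twoPointDoubling_of_crux (existsScaleCovariantLimit_of_summit h)

/-- **S ⟹ 0635** (`HasPointwiseScalingLimit.exists_isingEta`). -/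
theorem isingEuclidUpgradeR3EtaExists_of_summit (h : _root_.Ising3DConformalLimit) :
    IsingEuclidUpgrade.IsingEuclidUpgradeR3EtaExists := by
  obtain ⟨ρ, Δ, S, hρ, -, hlim, hnd, -, -⟩ := h
  obtain ⟨η, -, hη⟩ := hlim.exists_isingEta hρ hnd
  exact ⟨η, hη⟩

/-- The placement in one line: C and S are both upstream of the two hub items, through
disjoint arguments (C: MMS + arithmetic; S: the funnel and the scaling-dimension window). -/
theorem hubs_of_crux_and_of_summit :
    (HelsonAxis.AxialHelsonCone →
      MirrorHoelderCompactness.TwoPointDoubling ∧ IsingEuclidUpgrade.IsingEuclidUpgradeR3EtaExists) ∧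
    (_root_.Ising3DConformalLimit →
      MirrorHoelderCompactness.TwoPointDoubling ∧ IsingEuclidUpgrade.IsingEuclidUpgradeR3EtaExists) :=
  ⟨fun h => ⟨twoPointDoubling_of_axialHelsonCone h, isingEuclidUpgradeR3EtaExists_of_axialHelsonCone h⟩,
   fun h => ⟨twoPointDoubling_of_summit h, isingEuclidUpgradeR3EtaExists_of_summit h⟩⟩

/-! ## §5 Profile separation: the cone is a sign condition, not a profile property -/

/-- The Hausdorff moment sequence `h n = 1/(n+1)`. -/
def h (n : ℕ) : ℝ := ((n : ℝ) + 1)⁻¹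

theorem h_pos (n : ℕ) : 0 < h n := by unfold h; positivity

/-- `h n = ∫₀¹ xⁿ dx`: a Hausdorff moment sequence (so completely monotone, all Hankel minors ≥ 0). -/
theorem h_eq_moment (n : ℕ) : h n = ∫ x in (0:ℝ)..1, x ^ n := by
  rw [integral_pow]
  simp [h]

theorem h_antitone : Antitone h := by
  refine antitone_nat_of_succ_le fun n => ?_
  unfold h
  push_cast
  exact inv_anti₀ (by positivity) (by linarith)

/-- Discrete log-convexity `h(n+1)² ≤ h(n) h(n+2)`. -/
theorem h_logConvex (n : ℕ) : h (n + 1) ^ 2 ≤ h n * h (n + 2) := by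
  unfold h
  push_cast
  rw [← mul_inv, inv_pow]
  refine inv_anti₀ (by positivity) ?_
  nlinarith

/-- All-scale doubling `h(2n) ≥ h(n)/2`. -/
theorem h_doubling (n : ℕ) : 1/2 * h n ≤ h (2 * n) := by
  unfold h
  push_cast
  rw [one_div, ← mul_inv]
  refine inv_anti₀ (by positivity) ?_
  nlinarith

/-- Exact power law with amplitude: `n · h n → 1`. -/
theorem h_powerLaw : Tendsto (fun n : ℕ => (n : ℝ) * h n) atTop (𝓝 1) := by
  have := tendsto_natCast_div_add_atTop (1 : ℝ)
  refine this.congr' (Eventually.of_forall fun n => ?_)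
  simp only [h, div_eq_mul_inv]

/-- **The cone FAILS for `h` at every scale**: `h(N) h(N b²) < h(N b)²` for `N ≥ 1`, `b ≥ 2`
(equivalently `N (b-1)² > 0`). -/
theorem h_anticone {N b : ℕ} (hN : 1 ≤ N) (hb : 2 ≤ b) : h N * h (N * b ^ 2) < h (N * b) ^ 2 := by
  unfold h
  push_cast
  rw [← mul_inv, inv_pow]
  refine inv_strictAnti₀ (by positivity) ?_
  have hN' : (1:ℝ) ≤ N := by exact_mod_cast hN
  have hb' : (2:ℝ) ≤ b := by exact_mod_cast hb
  nlinarith [mul_pos (by linarith : (0:ℝ) < N) (mul_pos (by linarith : (0:ℝ) < b - 1) (by linarith : (0:ℝ) < b - 1))]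

theorem not_cone_h : ¬ ∃ ℓ₀ : ℕ, 0 < ℓ₀ ∧ Cone h ℓ₀ := by
  rintro ⟨ℓ₀, hℓ, hcone⟩
  have h1 := hcone ℓ₀ 2 le_rfl (by norm_num)
  have h2 := h_anticone (N := ℓ₀) (b := 2) hℓ le_rfl
  linarith

/-- **Profile separation.** There is a sequence with every axis-profile property the tree extracts
from the sub-problem for `g` (positivity, MMS antitonicity, log-convexity, all-scale doubling = 6150,
an exact decay exponent with amplitude ⊋ 0635) which violates the abstract crux. Hence no argument
`S ⟹ C` can factor through these properties: the cone is a genuine SIGN condition on the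
sub-leading axial corrections to scaling. -/
theorem profile_separation :
    ∃ f : ℕ → ℝ, (∀ n, 0 < f n) ∧ Antitone f ∧ (∀ n, f (n + 1) ^ 2 ≤ f n * f (n + 2)) ∧
      (∀ n, 1/2 * f n ≤ f (2 * n)) ∧ Tendsto (fun n : ℕ => (n : ℝ) * f n) atTop (𝓝 1) ∧
      ¬ ∃ ℓ₀ : ℕ, 0 < ℓ₀ ∧ Cone f ℓ₀ :=
  ⟨h, h_pos, h_antitone, h_logConvex, h_doubling, h_powerLaw, not_cone_h⟩

end

end Summit.CriticalPhenomena.Ising3DConformalLimit.Cruxes.AxialHelsonCone.RedirectR1
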